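import Mathlib.Data.List.GetD
import Literature.Computability.Complexity.Circuit
import Literature.Computability.Complexity.CircuitComposition
import Literature.Computability.Complexity.NegationElimination
import Literature.Computability.Complexity.SliceFunctions
import HarnessLib

/-!
# Slice functions: proofs (Jukna 2012, Theorem 10.1; Berkowitz 1982)

Discharge file for the named facts of `Literature/Computability/Complexity/SliceFunctions.lean`.
Everything in this file is PROVED (no definitions, no named facts).

* `GateList.exists_deNeg` — *negated inputs as new variables* (Jukna 2012, §10.1.1, p. 300:
  `f(x) = F(x, ¬x₁, …, ¬xₙ)`): a program over `{∧₂, ∨₂, ¬, 0, 1}` with tight negations has a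
  companion over `{∧₂, ∨₂, 0, 1}` on the doubled inputs `ι ⊕ ι`, of the same length, with the
  same gate values on `(x, ¬x)`; such programs are monotone in their input
  (`GateList.monotone_wireOf_vals_monotoneBasis01`).
* `berkowitz_sliceMonotonization_of_pseudoComplements_cktSize` — **Theorem 10.1 from the
  pseudo-complement circuit**: the printed proof of Jukna's Theorem 10.1 (substitute the outputs
  of the circuit of `pseudoComplements_cktSize` for the negated inputs; (10.1) on the slice, the
  monotone sandwich `F(x, 0, …, 0) ≤ F(x, ¬x) ≤ F(x, 1, …, 1)` off the slice).

## References
* S. Jukna, *Boolean Function Complexity: Advances and Frontiers*, Springer (2012), §10.1.1 and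
  Theorem 10.1 (PDF pp. 299–300) [Jukna2012].
* S. J. Berkowitz, *On some relationships between monotone and non-monotone circuit complexity*,
  Technical Report, University of Toronto (1982) [Berkowitz1982].
* I. Wegener, *The Complexity of Boolean Functions*, Wiley–Teubner (1987), §6.13, Thm. 13.1 and
  Thm. 13.3 [Wegener1987].
-/

namespace Literature.Computability.Complexity

open Finset GateList

variable {ι : Type*}

/-! ### Proof of Theorem 10.1 from the pseudo-complement circuit (Jukna 2012, p. 300)

The printed proof, in the tree's straight-line model. Write the given DeMorgan circuit as
`f(x) = F(x, ¬x₁, …, ¬xₙ)` with `F` a circuit over `{∧₂, ∨₂, 0, 1}` on `2n` inputs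
(`GateList.exists_deNeg`: a NOT gate reading the input `xᵢ` becomes an AND gate reading the
fresh input `yᵢ` twice, so gate positions are unchanged); `F` is monotone
(`GateList.monotone_wireOf_vals_monotoneBasis01`). Put the pseudo-complement program `P` of
`pseudoComplements_cktSize` in front and feed its outputs into the fresh inputs
(`GateList.vals_append_reloc`): the result computes `F₊(x) = F(x, Th_k(x - x₁), …, Th_k(x - xₙ))`
with `|P| + |C|` gates. On the slice `F₊ = F(x, ¬x) = f` by (10.1); below the slice all
pseudo-complements are `0` and `F₊(x) ≤ F(x, ¬x) = f(x) = 0`; above they are all `1` and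
`F₊(x) ≥ F(x, ¬x) = f(x) = 1`.
-/

namespace GateList

open GateList

/-- The gates of `{∧₂, ∨₂, 0, 1}` compute monotone Boolean functions. [folklore] -/
theorem monotone_of_mem_monotoneBasis01 {g : GateFn} (hg : g ∈ monotoneBasis01) :
    Monotone g.2 := by
  simp only [monotoneBasis01, monotoneBasis, Set.mem_insert_iff, Set.mem_singleton_iff] at hg
  intro v w hvw
  rw [Bool.le_iff_imp]
  rcases hg with rfl | rfl | rfl | rfl
  · exact id
  · exact id
  · simp only [GateFn.and, decide_eq_true_eq]
    exact fun h i => Bool.le_iff_imp.1 (hvw i) (h i)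
  · simp only [GateFn.or, decide_eq_true_eq]
    exact fun ⟨i, hi⟩ => ⟨i, Bool.le_iff_imp.1 (hvw i) hi⟩

/-- Every wire of a program over `{∧₂, ∨₂, 0, 1}` carries a monotone function of the input
("the circuit `F` itself is monotone, that is, has only AND and OR gates", Jukna 2012, p. 300;
induction along the program, cf. `monotone_wireOf_vals` for `{∧₂, ∨₂}`). [folklore] -/
theorem monotone_wireOf_vals_monotoneBasis01 (gs : List (Gate ι))
    (hgs : ∀ g ∈ gs, g.fn ∈ monotoneBasis01) (w : ι ⊕ ℕ) :
    Monotone fun x => wireOf x (vals gs x) w := by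
  induction gs using List.reverseRecOn generalizing w with
  | nil =>
    rcases w with i | m
    · exact fun x y hxy => hxy i
    · exact fun x y _ => le_rfl
  | append_singleton gs g ih =>
    have ih' := ih fun g' hg' => hgs g' (List.mem_append_left _ hg')
    have hg : Monotone g.op :=
      monotone_of_mem_monotoneBasis01 (hgs g (List.mem_append_right _ (List.mem_singleton_self g)))
    rcases w with i | m
    · exact fun x y hxy => hxy i
    · intro x y hxy
      show (vals (gs ++ [g]) x).getD m false ≤ (vals (gs ++ [g]) y).getD m false
      rcases lt_trichotomy m gs.length with hm | rfl | hm
      · have key : ∀ z, (vals (gs ++ [g]) z).getD m false = (vals gs z).getD m false :=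
          fun z => by
            rw [vals_append_singleton,
              List.getD_append _ _ _ _ (hm.trans_eq (length_vals gs z).symm)]
        rw [key, key]
        exact ih' (.inr m) hxy
      · have key : ∀ z, (vals (gs ++ [g]) z).getD gs.length false =
            g.op (fun a => wireOf z (vals gs z) (g.args a)) := fun z => by
          rw [vals_append_singleton, List.getD_append_right _ _ _ _ (length_vals gs z).le,
            length_vals, Nat.sub_self, List.getD_cons_zero]
        rw [key, key]
        exact hg fun a => ih' (g.args a) hxy
      · have key : ∀ z, (vals (gs ++ [g]) z).getD m false = false := fun z =>
          List.getD_eq_default _ _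
            (by rw [length_vals, List.length_append, List.length_singleton]; omega)
        rw [key, key]

/-- **Negated inputs as new variables** (Jukna 2012, p. 300:
`f(x₁, …, xₙ) = F(x₁, …, xₙ, ¬x₁, …, ¬xₙ)`). A program over `{∧₂, ∨₂, ¬, 0, 1}` whose NOT gates
read input variables only has a companion program over `{∧₂, ∨₂, 0, 1}` on the doubled input
set `ι ⊕ ι`, of the same length, whose gate values on `(x, ¬x)` are those of the original on `x`
(each NOT gate `¬xᵢ` becomes `yᵢ ∧ yᵢ`, every other gate is kept, reading `xᵢ` as the left copy).
[cite: Jukna2012, §10.1.1 (PDF p. 300)] -/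
theorem exists_deNeg (gs : List (Gate ι)) (hwf : WF gs) (hB : ∀ g ∈ gs, g.fn ∈ deMorganBasis01)
    (ht : ∀ g ∈ gs, g.fn = GateFn.not → ∀ a : Fin g.arity, ∃ i : ι, g.args a = Sum.inl i) :
    ∃ ds : List (Gate (ι ⊕ ι)), WF ds ∧ (∀ g ∈ ds, g.fn ∈ monotoneBasis01) ∧
      ds.length = gs.length ∧
      ∀ x : ι → Bool, vals ds (Sum.elim x fun i => !x i) = vals gs x := by
  induction gs using List.reverseRecOn with
  | nil => exact ⟨[], WF.nil, by simp, rfl, fun _ => rfl⟩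
  | append_singleton gs g ih =>
    obtain ⟨ds, hdwf, hdB, hdlen, hdvals⟩ := ih hwf.of_append_left
      (fun g' hg' => hB g' (List.mem_append_left _ hg'))
      (fun g' hg' => ht g' (List.mem_append_left _ hg'))
    have hgmem : g ∈ gs ++ [g] := List.mem_append_right _ (List.mem_singleton_self g)
    have hgOK : GateOK gs.length g := hwf.getLast
    by_cases hnot : g.fn = GateFn.not
    · -- a NOT gate reading the input `i`: replace by `yᵢ ∧ yᵢ`
      obtain ⟨w, rfl⟩ := exists_eq_notGate_of_fn_eq hnot
      obtain ⟨i, hi⟩ := ht _ hgmem rfl (0 : Fin 1)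
      change w = Sum.inl i at hi
      subst hi
      refine ⟨ds ++ [andGate (.inl (.inr i)) (.inl (.inr i))],
        hdwf.append_singleton (gateOK_andGate (fun _ h => by cases h) (fun _ h => by cases h)),
        fun g' hg' => ?_, by simp [hdlen], fun x => ?_⟩
      · rcases List.mem_append.1 hg' with h | h
        · exact hdB g' h
        · rw [List.mem_singleton.1 h]
          exact monotoneBasis_subset_monotoneBasis01 and_mem_monotoneBasis
      · rw [vals_append_singleton, vals_append_singleton, hdvals x, andGate_op]
        simp [notGate]
    · -- any other gate is kept, reading the left copy of the inputs
      set ρ : ι → (ι ⊕ ι) ⊕ ℕ := fun i => Sum.inl (Sum.inl i) with hρ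
      have hρOK : WiresOK 0 ρ := wiresOK_inl 0 Sum.inl
      refine ⟨ds ++ [reloc ρ 0 g], hdwf.append_singleton ?_, fun g' hg' => ?_, by simp [hdlen],
        fun x => ?_⟩
      · have := hgOK.reloc (L := 0) hρOK
        rw [Nat.zero_add] at this
        exact hdlen ▸ this
      · rcases List.mem_append.1 hg' with h | h
        · exact hdB g' h
        · rw [List.mem_singleton.1 h, reloc_fn]
          exact mem_monotoneBasis01_of_ne_not (hB g hgmem) hnot
      · rw [vals_append_singleton, vals_append_singleton, hdvals x]
        congr 2
        refine congrArg g.op (funext fun a => ?_)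
        change wireOf _ (vals gs x) (shiftWire ρ 0 (g.args a)) = _
        cases g.args a with
        | inl j => rfl
        | inr m => simp [shiftWire]

end GateList

/-- Below the slice every pseudo-complement is `0`: `|x| < k` gives `∑_{j ≠ i} xⱼ ≤ |x| < k`
(Jukna 2012, p. 300). [cite: Jukna2012, §10.1.1 (PDF p. 300)] -/
theorem pseudoComplement_eq_false_of_lt {n k : ℕ} (i : Fin n) (x : Fin n → Bool)
    (hx : hammingWeight x < k) : pseudoComplement k i x = false := by
  unfold pseudoComplement hammingWeight at *
  rw [decide_eq_false_iff_not, not_le]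
  refine lt_of_le_of_lt (card_le_card fun j hj => ?_) hx
  simp only [mem_filter, mem_univ, true_and] at hj ⊢
  exact hj.2

/-- Above the slice every pseudo-complement is `1`: `|x| > k` gives `∑_{j ≠ i} xⱼ ≥ |x| - 1 ≥ k`
(Jukna 2012, p. 300, "the case of input vectors with more than `k` ones is dual").
[cite: Jukna2012, §10.1.1 (PDF p. 300)] -/
theorem pseudoComplement_eq_true_of_lt {n k : ℕ} (i : Fin n) (x : Fin n → Bool)
    (hx : k < hammingWeight x) : pseudoComplement k i x = true := by
  classical
  unfold pseudoComplement hammingWeight at *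
  rw [decide_eq_true_eq]
  have hsub : (univ.filter fun j => x j = true) ⊆
      insert i (univ.filter fun j => j ≠ i ∧ x j = true) := by
    intro j hj
    simp only [mem_filter, mem_univ, true_and] at hj
    by_cases hji : j = i
    · subst hji; exact mem_insert_self _ _
    · exact mem_insert_of_mem (by simp [hji, hj])
  have := (card_le_card hsub).trans (card_insert_le _ _)
  omega

open GateList in
/-- **Theorem 10.1 from the pseudo-complement circuit** (Jukna 2012, Thm. 10.1, PDF p. 300;
Berkowitz 1982): the printed proof — replace the negated inputs of the DeMorgan circuit by the
outputs of the monotone circuit computing all `Th_k(x - xᵢ)` (`pseudoComplements_cktSize`), and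
check `F₊ = f` on, below and above the `k`-th slice by (10.1) and the monotone sandwich
`F(x, 0, …, 0) ≤ F(x, ¬x) ≤ F(x, 1, …, 1)`. [cite: Jukna2012, Thm. 10.1 (PDF p. 300)] -/
theorem berkowitz_sliceMonotonization_of_pseudoComplements_cktSize
    (h : pseudoComplements_cktSize) : berkowitz_sliceMonotonization := by
  obtain ⟨c, n₀, hP⟩ := h
  refine ⟨c, n₀, fun n hn k f hf C hCB hCt hCf => ?_⟩
  obtain ⟨P, outP, hPlen, hPR⟩ := hP n hn k
  obtain ⟨ds, hdwf, hdB, hdlen, hdvals⟩ := exists_deNeg C.gates (wf_gates C) hCB hCt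
  -- `F(x, y)`: the de-negated circuit as a function of inputs and fresh inputs
  set oD : (Fin n ⊕ Fin n) ⊕ ℕ := shiftWire (fun i => Sum.inl (Sum.inl i)) 0 C.output with hoD
  set F : (Fin n ⊕ Fin n → Bool) → Bool := fun y => wireOf y (vals ds y) oD with hF
  have hFmono : Monotone F := monotone_wireOf_vals_monotoneBasis01 ds hdB oD
  have hFf : ∀ x : Fin n → Bool, F (Sum.elim x fun i => !x i) = f x := by
    intro x
    rw [← hCf x, circuit_eval, hF]
    dsimp only
    rw [hdvals x, hoD]
    cases C.output with
    | inl i => rfl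
    | inr m => simp [shiftWire]
  -- the pseudo-complements, and `F₊(x) = F(x, Th_k(x - x₁), …, Th_k(x - xₙ)) = f(x)`
  set pc : (Fin n → Bool) → Fin n ⊕ Fin n → Bool :=
    fun x => Sum.elim x fun i => pseudoComplement k i x with hpc
  have hFpc : ∀ x, F (pc x) = f x := by
    intro x
    rcases lt_trichotomy (hammingWeight x) k with hlt | heq | hgt
    · -- below the slice
      have hle : pc x ≤ Sum.elim x fun i => !x i := by
        rintro (i | i)
        · exact le_rfl
        · simp [hpc, pseudoComplement_eq_false_of_lt i x hlt]
      have h1 := hFmono hle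
      rw [hFf x, hf.1 x hlt] at h1
      rw [hf.1 x hlt]
      exact le_antisymm h1 (Bool.false_le _)
    · -- on the slice, (10.1)
      have : pc x = Sum.elim x fun i => !x i := by
        funext w
        rcases w with i | i
        · rfl
        · exact pseudoComplement_eq_not i x heq
      rw [this, hFf x]
    · -- above the slice
      have hle : (Sum.elim x fun i => !x i) ≤ pc x := by
        rintro (i | i)
        · exact le_rfl
        · simp [hpc, pseudoComplement_eq_true_of_lt i x hgt]
      have h1 := hFmono hle
      rw [hFf x, hf.2 x hgt] at h1
      rw [hf.2 x hgt]
      exact le_antisymm (Bool.le_true _) h1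
  -- the combined program: `P`, then `ds` reading `xᵢ` and the outputs of `P`
  set ρ : Fin n ⊕ Fin n → Fin n ⊕ ℕ := Sum.elim (fun i => Sum.inl i) outP with hρ
  have hρOK : WiresOK P.length ρ := by
    rintro (i | i) m hm
    · cases hm
    · exact hPR.outOK i m hm
  have hwf' : WF (P ++ ds.map (reloc ρ P.length)) := hPR.wf.append_reloc hdwf hρOK
  have hoDOK : ∀ m, oD = .inr m → m < ds.length := by
    intro m hm
    rw [hoD] at hm
    cases hC : C.output with
    | inl i => rw [hC] at hm; cases hm
    | inr m' =>
      rw [hC] at hm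
      simp only [shiftWire, add_zero, Sum.inr.injEq] at hm
      subst hm
      rw [hdlen]
      exact C.wf_output m' hC
  have ho' : ∀ m, shiftWire ρ P.length oD = .inr m → m < (P ++ ds.map (reloc ρ P.length)).length := by
    intro m hm
    have := wiresOK_shiftWire (out := fun _ : Unit => oD) hρOK (fun _ m h => hoDOK m h) () m hm
    simpa using this
  refine ⟨toCircuit _ _ hwf' ho', ?_, fun x => ?_, ?_⟩
  · -- over `{∧₂, ∨₂, 0, 1}`
    intro g hg
    rcases List.mem_append.1 hg with h | h
    · exact hPR.isOver g h
    · obtain ⟨g', hg', rfl⟩ := List.mem_map.1 h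
      rw [reloc_fn]
      exact hdB g' hg'
  · -- computes `f`
    rw [circuit_eval]
    change wireOf x (vals (P ++ ds.map (reloc ρ P.length)) x) (shiftWire ρ P.length oD) = f x
    rw [vals_append_reloc P ds ρ hρOK x, wireOf_shiftWire x _ _ (length_vals P x) ρ hρOK oD]
    have hy : (fun j => wireOf x (vals P x) (ρ j)) = pc x := by
      funext j
      rcases j with i | i
      · rfl
      · exact hPR.eval x i
    rw [hy]
    exact hFpc x
  · -- size
    change (P ++ ds.map (reloc ρ P.length)).length ≤ C.gates.length + c * (n * Nat.log 2 n ^ 2)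
    rw [List.length_append, List.length_map, hdlen]
    omega

end Literature.Computability.Complexity
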